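import Literature.Combinatorics.SimpleGraph.GridFormulaGadgets
import Literature.Barriers.CriticalPhenomena.GridSAWGridFormulaCellsFP
import HarnessLib

/-!
# The gadget specification of the grid graph of a formula is typed polynomial time

Continuation of `GridSAWGridFormulaCellsFP.lean` (machine half of `GridSAW.LOT2003_lemma4_gadgets`,
Liśkiewicz–Ogihara–Toda 2003, Lemma 4: "It is not hard to see that `R` is polynomial-time
computable"), for the gadget layer `GridFormulaGadgets.lean` of the grid-native construction
(`Literature.Combinatorics.SimpleGraph.GridFormula`): the specification `gad ψ g : Option GadSpec`
of every gadget (an XOR-chord between two slots of two cells, or an OR-gadget on one or three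
clause-row terminals) is computed in typed polynomial time from the code of `ψ` and `g`, as a
5-tuple of numbers (`gadN`: kind, first cell, first slot, second cell, second slot; slots
`(a, b) : Fin 16 × Fin 16` as `16 a + b`, `slotN`, injective).

* `slotN`, `slotN_injective`; `codeFP_rowInSlotN`, `codeFP_rowOutSlotN`, `codeFP_colOutSlotN`,
  **`codeFP_landSlotN`** (the port slots of a tile and the landing slot of a column);
* `codeFP_cstart` (the first column of a clause), `codeFP_clauseLen`, `codeFP_len`,
  `codeFP_ngadgets`;
* `specN`, `gadN` (injective numberings of `GadSpec` / `Option GadSpec`), the arithmetic mirrors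
  `tileGadN`, `clauseGadN`, `gadN'` with `gadN_tileGad`, `gadN_clauseGad`, **`gadN_gad`**, and
  **`codeFP_gadN`**: `(ψ, g) ↦ gadN (gad ψ g)` is typed polynomial time.

## References

* M. Liśkiewicz, M. Ogihara, S. Toda, TCS 304 (2003) 129–156, §3 (proof of Lemma 4).
* S. Arora, B. Barak, *Computational Complexity: A Modern Approach*, CUP 2009, §1.3.
-/

namespace Literature.Barriers.CriticalPhenomena.GridSAW

namespace GridFormulaFP

open _root_.Computability Polynomial Literature.Computability.Complexity Literature.Computability.Complexity.CodeFP
open Literature.Combinatorics.SimpleGraph Literature.Combinatorics.SimpleGraph.GridFormula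
open Literature.Combinatorics.SimpleGraph.GridFormula.Slot
open Literature.Combinatorics.SimpleGraph.GridCell (CellTy)

/-! ### Slots as numbers -/

/-- A local slot `(a, b)` as the number `16 a + b`. [folklore] -/
def slotN (e : Fin 16 × Fin 16) : ℕ := 16 * e.1.val + e.2.val

/-- `slotN` is injective. [folklore] -/
theorem slotN_injective : Function.Injective slotN := by
  rintro ⟨a, b⟩ ⟨c, d⟩ h
  simp only [slotN] at h
  have ha := a.isLt; have hb := b.isLt; have hc := c.isLt; have hd := d.isLt
  have h1 : a.val = c.val := by omega
  have h2 : b.val = d.val := by omega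
  exact Prod.ext (Fin.ext h1) (Fin.ext h2)

/-- `tileTyN t = 1` iff the tile is a tap. [folklore] -/
theorem tileTyN_eq_one_iff {t : TileTy} : tileTyN t = 1 ↔ t = .tap := by
  cases t <;> simp [tileTyN]

section Slots

/-- The code of the triple context `(ψ, i, j)`. -/
local notation "E3" => pairE cnfC (pairE natE natE)

/-- The crossing test of a tile. [cite: AroraBarak2009, §1.3] -/
theorem codeFP_isCross : CodeFP E3 bitE (fun p => decide (tileTyN (tileTy p.1 p.2.1 p.2.2) = 2)) :=
  (natEq.comp (codeFP_tileTyN.pair (const _ 2))).congr fun _ => rfl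

/-- The tap test of a tile. [cite: AroraBarak2009, §1.3] -/
theorem codeFP_isTap : CodeFP E3 bitE (fun p => decide (tileTyN (tileTy p.1 p.2.1 p.2.2) = 1)) :=
  (natEq.comp (codeFP_tileTyN.pair (const _ 1))).congr fun _ => rfl

/-- **The entry slot of a row wire** `(ψ, i, j) ↦ slotN (rowInSlot ψ i j)`. [cite: AroraBarak2009, §1.3] -/
theorem codeFP_rowInSlotN : CodeFP E3 natE (fun p => slotN (rowInSlot p.1 p.2.1 p.2.2)) :=
  (codeFP_isCross.ite (const _ (slotN pN0)) (const _ (slotN bN3))).congr fun p => by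
    unfold rowInSlot
    by_cases h : tileTy p.1 p.2.1 p.2.2 = .cross
    · simp [h, tileTyN]
    · simp [h, show ¬ tileTyN (tileTy p.1 p.2.1 p.2.2) = 2 from fun h' => h (tileTyN_eq_two_iff.1 h')]

/-- **The exit slot of a row wire** `(ψ, i, j) ↦ slotN (rowOutSlot ψ i j)`. [cite: AroraBarak2009, §1.3] -/
theorem codeFP_rowOutSlotN : CodeFP E3 natE (fun p => slotN (rowOutSlot p.1 p.2.1 p.2.2)) :=
  (codeFP_isCross.ite (const _ (slotN pN8)) (const _ (slotN bN6))).congr fun p => by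
    unfold rowOutSlot
    by_cases h : tileTy p.1 p.2.1 p.2.2 = .cross
    · simp [h, tileTyN]
    · simp [h, show ¬ tileTyN (tileTy p.1 p.2.1 p.2.2) = 2 from fun h' => h (tileTyN_eq_two_iff.1 h')]

/-- **The exit slot of a column wire** `(ψ, i, j) ↦ slotN (colOutSlot ψ i j)`. [cite: AroraBarak2009, §1.3] -/
theorem codeFP_colOutSlotN : CodeFP E3 natE (fun p => slotN (colOutSlot p.1 p.2.1 p.2.2)) :=
  (codeFP_isTap.ite (const _ (slotN bS1)) (const _ (slotN tS8))).congr fun p => by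
    unfold colOutSlot
    by_cases h : tileTy p.1 p.2.1 p.2.2 = .tap
    · simp [h, tileTyN]
    · simp [h, show ¬ tileTyN (tileTy p.1 p.2.1 p.2.2) = 1 from fun h' => h (tileTyN_eq_one_iff.1 h')]

end Slots

/-- **The landing slot of a column** `(ψ, j) ↦ slotN (landSlot ψ j)` (parity of the crossings
below the tap against the polarity). [cite: AroraBarak2009, §1.3] -/
theorem codeFP_landSlotN : CodeFP (pairE cnfC natE) natE (fun p => slotN (landSlot p.1 p.2)) := by
  have hV : CodeFP (pairE cnfC natE) natE (fun p => V p.1) := codeFP_V.comp (fst _ _)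
  have hvar : CodeFP (pairE cnfC natE) natE (fun p => varOf p.1 p.2) := codeFP_varOf
  have hr : CodeFP (pairE cnfC natE) natE (fun p => rowOf p.1 (varOf p.1 p.2)) :=
    (codeFP_rowOf.comp ((fst _ _).pair hvar)).congr fun _ => rfl
  have hlhs : CodeFP (pairE cnfC natE) natE (fun p => (V p.1 - 1 - rowOf p.1 (varOf p.1 p.2)) % 2) :=
    (natMod.comp ((natSub.comp ((natSub.comp (hV.pair (const _ 1))).pair hr)).pair (const _ 2))).congr fun _ => rfl
  have hrhs : CodeFP (pairE cnfC natE) natE (fun p => if polOf p.1 p.2 then 0 else 1) :=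
    codeFP_polOf.ite (const _ 0) (const _ 1)
  have hc : CodeFP (pairE cnfC natE) bitE
      (fun p => decide ((V p.1 - 1 - rowOf p.1 (varOf p.1 p.2)) % 2 = if polOf p.1 p.2 then 0 else 1)) :=
    (natEq.comp (hlhs.pair hrhs)).congr fun _ => rfl
  exact (hc.ite (const _ (slotN bN3)) (const _ (slotN bN0))).congr fun p => by
    unfold landSlot
    by_cases h : (V p.1 - 1 - rowOf p.1 (varOf p.1 p.2)) % 2 = (if polOf p.1 p.2 then 0 else 1) <;> simp [h]

/-! ### Clause bookkeeping -/

/-- The input CNF as a raw list of clauses. [cite: AroraBarak2009, §1.3] -/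
theorem codeFP_rawClauses : CodeFP (pairE cnfC natE) (rawE clauseC) (fun p => p.1) :=
  ((rawOfList clauseC).comp (fst _ _)).congr fun _ => rfl

/-- **The first column of a clause** `(ψ, q) ↦ cstart ψ q = |(ψ.take q).flatten|`. [cite: AroraBarak2009, §1.3] -/
theorem codeFP_cstart : CodeFP (pairE cnfC natE) natE (fun p => cstart p.1 p.2) := by
  have ht : CodeFP (pairE cnfC natE) (rawE clauseC) (fun p => p.1.take p.2) :=
    ((rawTakeNat clauseC).comp ((snd _ _).pair codeFP_rawClauses)).congr fun _ => rfl
  have hf : CodeFP (pairE cnfC natE) (rawE litC) (fun p => (p.1.take p.2).flatten) :=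
    ((flatten litC).comp ((map₀ (rawOfList litC)).comp ht)).congr fun p => by simp
  exact ((natLength litC).comp hf).congr fun _ => rfl

/-- The lengths of the clauses. [cite: AroraBarak2009, §1.3] -/
theorem codeFP_clauseLens : CodeFP (pairE cnfC natE) (rawE natE) (fun p => p.1.map List.length) :=
  ((map₀ ((natLength litC).comp (rawOfList litC))).comp codeFP_rawClauses).congr fun _ => rfl

/-- **The length of clause `q`** (as `(ψ.map length).getD q 0`). [cite: AroraBarak2009, §1.3] -/
theorem codeFP_clauseLen : CodeFP (pairE cnfC natE) natE (fun p => (p.1.map List.length).getD p.2 0) :=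
  ((rawGetD natE (d := 0) rfl).comp (codeFP_clauseLens.pair (snd _ _))).congr fun _ => rfl

/-- `getD` of the length list is the length of the clause. [folklore] -/
theorem getD_map_length {ψ : CNF ℕ} {q : ℕ} (hq : q < ψ.length) : (ψ.map List.length).getD q 0 = ψ[q].length := by
  rw [List.getD_eq_getElem _ _ (by simpa using hq), List.getElem_map]

/-- The number of clauses. [cite: AroraBarak2009, §1.3] -/
theorem codeFP_len : CodeFP cnfC natE (fun ψ : CNF ℕ => ψ.length) :=
  ((natLength clauseC).comp (rawOfList clauseC)).congr fun _ => rfl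

/-- **The number of gadget indices** `ngadgets ψ = 8 V N + N + |ψ|`. [cite: AroraBarak2009, §1.3] -/
theorem codeFP_ngadgets : CodeFP cnfC natE ngadgets := by
  have hVN : CodeFP cnfC natE (fun ψ => V ψ * N ψ) := natMul.comp (codeFP_V.pair codeFP_N)
  exact (natAdd.comp ((natAdd.comp ((natMul.comp ((const _ 8).pair hVN)).pair codeFP_N)).pair codeFP_len)).congr
    fun ψ => by unfold ngadgets; rfl

/-! ### Gadget specifications as numbers -/

/-- A 5-tuple of numbers. -/
local notation "T5" => ℕ × ℕ × ℕ × ℕ × ℕ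

/-- Its code. -/
local notation "t5E" => pairE natE (pairE natE (pairE natE (pairE natE natE)))

/-- **A gadget specification as numbers**: kind `0` = XOR-chord `(k₁, e₁, k₂, e₂)`, kind `1` =
one-input OR on terminal `k`, kind `2` = three-input OR on terminals `k, k+1, k+2`. [folklore] -/
def specN : GadSpec → T5
  | .xor k₁ e₁ k₂ e₂ => (0, k₁, slotN e₁, k₂, slotN e₂)
  | .or1 k => (1, k, 0, 0, 0)
  | .or3 k => (2, k, 0, 0, 0)

/-- The tuple of "no gadget" (kind `3`). [folklore] -/
def noneN : T5 := (3, 0, 0, 0, 0)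

/-- **An optional gadget specification as numbers.** [folklore] -/
def gadN : Option GadSpec → T5
  | none => noneN
  | some s => specN s

/-- `specN` is injective. [folklore] -/
theorem specN_injective : Function.Injective specN := by
  intro s s' h
  cases s <;> cases s' <;> simp only [specN, Prod.mk.injEq] at h
  · obtain ⟨-, rfl, h₁, rfl, h₂⟩ := h
    rw [slotN_injective h₁, slotN_injective h₂]
  all_goals first | (obtain ⟨h0, -⟩ := h; simp at h0) | (obtain ⟨-, rfl, -⟩ := h; rfl)

/-- `gadN` is injective. [folklore] -/
theorem gadN_injective : Function.Injective gadN := by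
  intro s s' h
  cases s with
  | none =>
    cases s' with
    | none => rfl
    | some t => cases t <;> simp [gadN, noneN, specN] at h
  | some t =>
    cases s' with
    | none => cases t <;> simp [gadN, noneN, specN] at h
    | some t' => rw [specN_injective h]

/-! ### The arithmetic mirrors of `tileGad`, `clauseGad`, `gad` -/

/-- Mirror of `tileGad` on numbers. [folklore] -/
def tileGadN (ψ : CNF ℕ) (i j r : ℕ) : T5 :=
  if tileTyN (tileTy ψ i j) = 2 then
    (if r = 0 then
      (if j = 0 then noneN
       else (0, tileCell ψ i (j - 1) 2, slotN (rowOutSlot ψ i (j - 1)), tileCell ψ i j 0, slotN pN0))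
     else if r = 1 then (0, tileCell ψ i j 0, slotN pS2, tileCell ψ i j 1, slotN tS0)
     else if r = 2 then (0, tileCell ψ i j 0, slotN pS0, tileCell ψ i j 1, slotN tS4r)
     else if r = 3 then (0, tileCell ψ i j 1, slotN tN2r, tileCell ψ i j 2, slotN pN0)
     else if r = 4 then (0, tileCell ψ i j 0, slotN pN8, tileCell ψ i j 2, slotN pN4)
     else if r = 5 then (0, tileCell ψ (i - 1) j 1, slotN (colOutSlot ψ (i - 1) j), tileCell ψ i j 0, slotN pN4)
     else noneN)
  else
    (if r = 0 then
      (if j = 0 then noneN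
       else (0, tileCell ψ i (j - 1) 2, slotN (rowOutSlot ψ i (j - 1)), tileCell ψ i j 0, slotN bN3))
     else if r = 1 then (0, tileCell ψ i j 0, slotN bN6, tileCell ψ i j 1, slotN bN3)
     else if r = 2 then (0, tileCell ψ i j 1, slotN bN6, tileCell ψ i j 2, slotN bN3)
     else noneN)

/-- `tileGadN` mirrors `tileGad`. [folklore] -/
theorem gadN_tileGad (ψ : CNF ℕ) (i j r : ℕ) : gadN (tileGad ψ i j r) = tileGadN ψ i j r := by
  unfold tileGad tileGadN
  simp only [tileTyN_eq_two_iff]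
  split_ifs <;> rfl

/-- Mirror of `clauseGad` on numbers. [folklore] -/
def clauseGadN (ψ : CNF ℕ) (q : ℕ) : T5 :=
  if q < ψ.length then
    (if (ψ.map List.length).getD q 0 = 1 then (1, clauseBead ψ (cstart ψ q), 0, 0, 0)
     else if (ψ.map List.length).getD q 0 = 3 then (2, clauseBead ψ (cstart ψ q), 0, 0, 0)
     else noneN)
  else noneN

/-- `clauseGadN` mirrors `clauseGad`. [folklore] -/
theorem gadN_clauseGad (ψ : CNF ℕ) (q : ℕ) : gadN (clauseGad ψ q) = clauseGadN ψ q := by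
  unfold clauseGad clauseGadN
  by_cases hq : q < ψ.length
  · rw [dif_pos hq, if_pos hq, getD_map_length hq]
    split_ifs <;> rfl
  · rw [dif_neg hq, if_neg hq]
    rfl

/-- Mirror of `gad` on numbers. [folklore] -/
def gadN' (ψ : CNF ℕ) (g : ℕ) : T5 :=
  if g < 8 * (V ψ * N ψ) then tileGadN ψ (g / 8 / N ψ) (g / 8 % N ψ) (g % 8)
  else if g - 8 * (V ψ * N ψ) < N ψ then
    (0, tileCell ψ (V ψ - 1) (g - 8 * (V ψ * N ψ)) 1, slotN (colOutSlot ψ (V ψ - 1) (g - 8 * (V ψ * N ψ))),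
      clauseBead ψ (g - 8 * (V ψ * N ψ)), slotN (landSlot ψ (g - 8 * (V ψ * N ψ))))
  else clauseGadN ψ (g - 8 * (V ψ * N ψ) - N ψ)

/-- **`gadN'` mirrors `gad`.** [folklore] -/
theorem gadN_gad (ψ : CNF ℕ) (g : ℕ) : gadN (gad ψ g) = gadN' ψ g := by
  unfold gad gadN'
  split_ifs
  · exact gadN_tileGad ψ _ _ _
  · rfl
  · exact gadN_clauseGad ψ _

/-! ### Typed polynomial time -/

section FP

variable {β : Type} {eβ : β → List Bool}

/-- An XOR-chord tuple from its four computed entries. [cite: AroraBarak2009, §1.3] -/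
theorem codeFP_xorTuple {f₁ f₂ f₃ f₄ : β → ℕ} (h₁ : CodeFP eβ natE f₁) (h₂ : CodeFP eβ natE f₂) (h₃ : CodeFP eβ natE f₃)
    (h₄ : CodeFP eβ natE f₄) : CodeFP eβ t5E (fun b => ((0, f₁ b, f₂ b, f₃ b, f₄ b) : T5)) :=
  ((const _ 0).pair (h₁.pair (h₂.pair (h₃.pair h₄)))).congr fun _ => rfl

/-- A tuple with a computed second entry. [cite: AroraBarak2009, §1.3] -/
theorem codeFP_kindTuple (c : ℕ) {f : β → ℕ} (h : CodeFP eβ natE f) : CodeFP eβ t5E (fun b => ((c, f b, 0, 0, 0) : T5)) :=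
  ((const _ c).pair (h.pair (const _ ((0, 0, 0) : ℕ × ℕ × ℕ)))).congr fun _ => rfl

/-- The code of the context `(ψ, i, j, r)`. -/
local notation "E4" => pairE cnfC (pairE natE (pairE natE natE))

/-- **`tileGadN` is typed polynomial time** in `(ψ, i, j, r)`. [cite: LiskiewiczOgiharaToda2003, §3 (proof of Lemma 4)] -/
theorem codeFP_tileGadN : CodeFP E4 t5E (fun p => tileGadN p.1 p.2.1 p.2.2.1 p.2.2.2) := by
  have hψ : CodeFP E4 cnfC (fun p => p.1) := fst _ _
  have hi : CodeFP E4 natE (fun p => p.2.1) := (snd _ _).fst'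
  have hj : CodeFP E4 natE (fun p => p.2.2.1) := (snd _ _).snd'.fst'
  have hr : CodeFP E4 natE (fun p => p.2.2.2) := (snd _ _).snd'.snd'
  have hi1 : CodeFP E4 natE (fun p => p.2.1 - 1) := (natSub.comp (hi.pair (const _ 1))).congr fun _ => rfl
  have hj1 : CodeFP E4 natE (fun p => p.2.2.1 - 1) := (natSub.comp (hj.pair (const _ 1))).congr fun _ => rfl
  -- tile cells `tileCell ψ a b c` for computed `a`, `b` and a constant `c`
  have cell : ∀ {a b : CNF ℕ × ℕ × ℕ × ℕ → ℕ} (c : ℕ), CodeFP E4 natE a → CodeFP E4 natE b →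
      CodeFP E4 natE (fun p => tileCell p.1 (a p) (b p) c) := fun c ha hb =>
    (codeFP_tileCell.comp (hψ.pair (ha.pair (hb.pair (const _ c))))).congr fun _ => rfl
  -- the computed slots
  have hro : CodeFP E4 natE (fun p => slotN (rowOutSlot p.1 p.2.1 (p.2.2.1 - 1))) :=
    (codeFP_rowOutSlotN.comp (hψ.pair (hi.pair hj1))).congr fun _ => rfl
  have hco : CodeFP E4 natE (fun p => slotN (colOutSlot p.1 (p.2.1 - 1) p.2.2.1)) :=
    (codeFP_colOutSlotN.comp (hψ.pair (hi1.pair hj))).congr fun _ => rfl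
  -- the tests
  have hcross : CodeFP E4 bitE (fun p => decide (tileTyN (tileTy p.1 p.2.1 p.2.2.1) = 2)) :=
    (codeFP_isCross.comp (hψ.pair (hi.pair hj))).congr fun _ => rfl
  have hj0 : CodeFP E4 bitE (fun p => decide (p.2.2.1 = 0)) := (natEq.comp (hj.pair (const _ 0))).congr fun _ => rfl
  have hrk : ∀ k : ℕ, CodeFP E4 bitE (fun p => decide (p.2.2.2 = k)) := fun k =>
    (natEq.comp (hr.pair (const _ k))).congr fun _ => rfl
  have hnone : CodeFP E4 t5E (fun _ => noneN) := const _ _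
  -- the tuples of a crossing tile
  have x0c := codeFP_xorTuple (cell 2 hi hj1) hro (cell 0 hi hj) (const E4 (slotN pN0))
  have x1c := codeFP_xorTuple (cell 0 hi hj) (const E4 (slotN pS2)) (cell 1 hi hj) (const E4 (slotN tS0))
  have x2c := codeFP_xorTuple (cell 0 hi hj) (const E4 (slotN pS0)) (cell 1 hi hj) (const E4 (slotN tS4r))
  have x3c := codeFP_xorTuple (cell 1 hi hj) (const E4 (slotN tN2r)) (cell 2 hi hj) (const E4 (slotN pN0))
  have x4c := codeFP_xorTuple (cell 0 hi hj) (const E4 (slotN pN8)) (cell 2 hi hj) (const E4 (slotN pN4))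
  have x5c := codeFP_xorTuple (cell 1 hi1 hj) hco (cell 0 hi hj) (const E4 (slotN pN4))
  -- the tuples of a plain tile
  have x0b := codeFP_xorTuple (cell 2 hi hj1) hro (cell 0 hi hj) (const E4 (slotN bN3))
  have x1b := codeFP_xorTuple (cell 0 hi hj) (const E4 (slotN bN6)) (cell 1 hi hj) (const E4 (slotN bN3))
  have x2b := codeFP_xorTuple (cell 1 hi hj) (const E4 (slotN bN6)) (cell 2 hi hj) (const E4 (slotN bN3))
  have hc := (hrk 0).ite (hj0.ite hnone x0c)
    ((hrk 1).ite x1c ((hrk 2).ite x2c ((hrk 3).ite x3c ((hrk 4).ite x4c ((hrk 5).ite x5c hnone)))))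
  have hb := (hrk 0).ite (hj0.ite hnone x0b) ((hrk 1).ite x1b ((hrk 2).ite x2b hnone))
  exact (hcross.ite hc hb).congr fun p => by
    unfold tileGadN
    simp only [decide_eq_true_eq]

/-- **`clauseGadN` is typed polynomial time** in `(ψ, q)`. [cite: LiskiewiczOgiharaToda2003, §3 (proof of Lemma 4)] -/
theorem codeFP_clauseGadN : CodeFP (pairE cnfC natE) t5E (fun p => clauseGadN p.1 p.2) := by
  have hq : CodeFP (pairE cnfC natE) natE (fun p => p.2) := snd _ _
  have hlen : CodeFP (pairE cnfC natE) natE (fun p => p.1.length) := codeFP_len.comp (fst _ _)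
  have hlt : CodeFP (pairE cnfC natE) bitE (fun p => decide (p.2 < p.1.length)) := (natLt.comp (hq.pair hlen)).congr fun _ => rfl
  have hk : ∀ k : ℕ, CodeFP (pairE cnfC natE) bitE (fun p => decide ((p.1.map List.length).getD p.2 0 = k)) := fun k =>
    (natEq.comp (codeFP_clauseLen.pair (const _ k))).congr fun _ => rfl
  have hbead : CodeFP (pairE cnfC natE) natE (fun p => clauseBead p.1 (cstart p.1 p.2)) :=
    (codeFP_clauseBead.comp ((fst _ _).pair codeFP_cstart)).congr fun _ => rfl
  have hnone : CodeFP (pairE cnfC natE) t5E (fun _ => noneN) := const _ _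
  exact ((hlt.ite ((hk 1).ite (codeFP_kindTuple 1 hbead) ((hk 3).ite (codeFP_kindTuple 2 hbead) hnone)) hnone)).congr
    fun p => by
      unfold clauseGadN
      simp only [decide_eq_true_eq]

/-- **`gadN'` is typed polynomial time** in `(ψ, g)`. [cite: LiskiewiczOgiharaToda2003, §3 (proof of Lemma 4)] -/
theorem codeFP_gadN' : CodeFP (pairE cnfC natE) t5E (fun p => gadN' p.1 p.2) := by
  have hψ : CodeFP (pairE cnfC natE) cnfC (fun p => p.1) := fst _ _
  have hg : CodeFP (pairE cnfC natE) natE (fun p => p.2) := snd _ _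
  have hN : CodeFP (pairE cnfC natE) natE (fun p => N p.1) := codeFP_N.comp (fst _ _)
  have hV : CodeFP (pairE cnfC natE) natE (fun p => V p.1) := codeFP_V.comp (fst _ _)
  have h8 : CodeFP (pairE cnfC natE) natE (fun p => 8 * (V p.1 * N p.1)) :=
    (natMul.comp ((const _ 8).pair (natMul.comp (hV.pair hN)))).congr fun _ => rfl
  have hd : CodeFP (pairE cnfC natE) natE (fun p => p.2 - 8 * (V p.1 * N p.1)) := (natSub.comp (hg.pair h8)).congr fun _ => rfl
  have hV1 : CodeFP (pairE cnfC natE) natE (fun p => V p.1 - 1) := (natSub.comp (hV.pair (const _ 1))).congr fun _ => rfl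
  -- the tile branch
  have hq8 : CodeFP (pairE cnfC natE) natE (fun p => p.2 / 8) := (natDiv.comp (hg.pair (const _ 8))).congr fun _ => rfl
  have hti : CodeFP (pairE cnfC natE) natE (fun p => p.2 / 8 / N p.1) := (natDiv.comp (hq8.pair hN)).congr fun _ => rfl
  have htj : CodeFP (pairE cnfC natE) natE (fun p => p.2 / 8 % N p.1) := (natMod.comp (hq8.pair hN)).congr fun _ => rfl
  have htr : CodeFP (pairE cnfC natE) natE (fun p => p.2 % 8) := (natMod.comp (hg.pair (const _ 8))).congr fun _ => rfl
  have htile : CodeFP (pairE cnfC natE) t5E (fun p => tileGadN p.1 (p.2 / 8 / N p.1) (p.2 / 8 % N p.1) (p.2 % 8)) :=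
    (codeFP_tileGadN.comp (hψ.pair (hti.pair (htj.pair htr)))).congr fun _ => rfl
  -- the landing branch
  have hcell : CodeFP (pairE cnfC natE) natE (fun p => tileCell p.1 (V p.1 - 1) (p.2 - 8 * (V p.1 * N p.1)) 1) :=
    (codeFP_tileCell.comp (hψ.pair (hV1.pair (hd.pair (const _ 1))))).congr fun _ => rfl
  have hco : CodeFP (pairE cnfC natE) natE (fun p => slotN (colOutSlot p.1 (V p.1 - 1) (p.2 - 8 * (V p.1 * N p.1)))) :=
    (codeFP_colOutSlotN.comp (hψ.pair (hV1.pair hd))).congr fun _ => rfl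
  have hbead : CodeFP (pairE cnfC natE) natE (fun p => clauseBead p.1 (p.2 - 8 * (V p.1 * N p.1))) :=
    (codeFP_clauseBead.comp (hψ.pair hd)).congr fun _ => rfl
  have hland : CodeFP (pairE cnfC natE) natE (fun p => slotN (landSlot p.1 (p.2 - 8 * (V p.1 * N p.1)))) :=
    (codeFP_landSlotN.comp (hψ.pair hd)).congr fun _ => rfl
  have hlanding := codeFP_xorTuple hcell hco hbead hland
  -- the clause branch
  have hcl : CodeFP (pairE cnfC natE) t5E (fun p => clauseGadN p.1 (p.2 - 8 * (V p.1 * N p.1) - N p.1)) :=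
    (codeFP_clauseGadN.comp (hψ.pair ((natSub.comp (hd.pair hN))))).congr fun _ => rfl
  -- the tests
  have c1 : CodeFP (pairE cnfC natE) bitE (fun p => decide (p.2 < 8 * (V p.1 * N p.1))) := (natLt.comp (hg.pair h8)).congr fun _ => rfl
  have c2 : CodeFP (pairE cnfC natE) bitE (fun p => decide (p.2 - 8 * (V p.1 * N p.1) < N p.1)) :=
    (natLt.comp (hd.pair hN)).congr fun _ => rfl
  exact (c1.ite htile (c2.ite hlanding hcl)).congr fun p => by
    unfold gadN'
    simp only [decide_eq_true_eq]

/-- **The gadget specification is typed polynomial time**: `(ψ, g) ↦ gadN (gad ψ g)`. [cite: LiskiewiczOgiharaToda2003, §3 (proof of Lemma 4: "It is not hard to see that R is polynomial-time computable")] -/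
theorem codeFP_gadN : CodeFP (pairE cnfC natE) t5E (fun p => gadN (gad p.1 p.2)) :=
  codeFP_gadN'.congr fun p => (gadN_gad p.1 p.2).symm

end FP

end GridFormulaFP

end Literature.Barriers.CriticalPhenomena.GridSAW
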